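import Literature.NumberTheory.EllipticCurves.TateCurve.DivisiblePoints
import Literature.AnabelianGeometry.AbsoluteAnabelian.AbsTopIII.KummerFaithfulPadicProofs
import HarnessLib

/-!
# [AbsTopIII] Def. 1.5 (a) / Rmk. 1.5.4 (i), abelian-variety clause — INSTANCE: the Tate curve over a `p`-adic
# field has no non-zero infinitely divisible rational point

Proof-only companion (no new definitions) of `AbsTopIII/KummerFaithful.lean` (S. Mochizuki, *Topics in Absolute
Anabelian Geometry III*, §1, Def. 1.5 p. 32 and Rmk. 1.5.4 (i) p. 33, manuscript pagination, lit key
`paper:url-5493eb38cbb7`). Def. 1.5 (a): "We have `⋂_{N ≥ 1} N · A(k_H) = {0}`"; Rmk. 1.5.4 (i): "if `k`, hence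
also `k_H`, is a finite extension of `ℚ_p`, then `A(k_H)` is an extension of a finitely generated `ℤ`-module by a
compact abelian `p`-adic Lie group [...]. In particular, the condition of Definition 1.5, (a), is satisfied."

The tree kernel-checks the TORUS half of Rmk. 1.5.4 (i) (`KummerFaithfulPadicProofs`,
`divisibleElementsTrivial_units_of_finite_padic`: `⋂_N (K^×)^N = {1}`); the ABELIAN-VARIETY clause is the open
residual of FACT-LIST row F-0369 (Mattuck's structure theorem; the tree's `AbelianVariety` is scheme-theoretic and
Mathlib has no Néron models). This file PROVES that clause for the one abelian variety the tree holds concretely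
over `p`-adic fields — the TATE CURVE `E_q` (`0 < ‖q‖ < 1`; by the tree's PROVED Silverman ATAEC V.5.3, every
elliptic curve with split multiplicative reduction), in Mathlib's point-group currency
`(tateCurve q).toAffine.Point`:

* **`tateCurve_point_eq_zero_of_forall_exists_nsmul_eq`** — for a finite extension `K` of `ℚ_p` with ANY normed
  field structure making it a normed `ℚ_p`-algebra, a `K`-point `P` of `E_q` with `P ∈ n·E_q(K)` for all `n ≥ 1`
  is `0`;
* **`divisibleElementsTrivial_tateCurve_points`** — the same as Def. 1.5 (a), `DivisibleElementsTrivial` of the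
  (multiplicatively written) Mordell–Weil group `E_q(K)`;
* `point_eq_zero_of_forall_exists_nsmul_eq_of_variableChange` — the same for every `E` with a change of variables
  `C • E = tateCurve q` over `K` (every split-multiplicative elliptic curve, by the tree's PROVED ATAEC V.5.3);
* `padic_point_eq_zero_of_forall_exists_nsmul_eq` / `rat_point_eq_zero_of_forall_exists_nsmul_eq` (v2) — over
  `ℚ_p` itself, UNCONDITIONALLY: an elliptic curve over `ℚ_p` (resp. over `ℚ`) with split multiplicative reduction
  (at `p`) has no non-zero infinitely divisible `ℚ_p`-point.

Route (elementary, no `p`-adic Lie groups): Tate's uniformisation `K^×/q^ℤ ≅ E_q(K)` (the tree's THEOREM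
`tateUniformizationMulEquiv`, Silverman ATAEC V.3.1 (c)(d)), the torus clause for `K^×`, and discreteness of the
value group (`TateCurve/DivisiblePoints.lean`). HONEST FRAMING: OUR kernel proof of a classical instance; it does
not discharge F-0369 (all abelian varieties) and bears on nothing disputed; no side taken on [IUTchIII] Cor. 3.12.
-/

noncomputable section

open scoped Classical

namespace Literature.AnabelianGeometry.AbsoluteAnabelian.AbsTopIII

open Literature.NumberTheory.EllipticCurves.TateCurve Literature.NumberTheory.EllipticCurves.SteinWuthrich2013
open WeierstrassCurve

universe u

variable (p : ℕ) [Fact p.Prime] {K : Type u} [NontriviallyNormedField K] [NormedAlgebra ℚ_[p] K]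
  [FiniteDimensional ℚ_[p] K]

include p in
/-- A finite extension of `ℚ_p`, with any normed-field structure making it a normed `ℚ_p`-algebra, is an
ultrametric space (its norm is the spectral norm, which is nonarchimedean). [cite: MochizukiAbsTopIII2015, Rmk 1.5.4 (i) p.33] -/
theorem isUltrametricDist_of_finite_padic : IsUltrametricDist K := by
  haveI : Algebra.IsAlgebraic ℚ_[p] K := Algebra.IsAlgebraic.of_finite ℚ_[p] K
  refine IsUltrametricDist.isUltrametricDist_of_isNonarchimedean_norm fun x y => ?_
  rw [NormedAlgebra.norm_eq_spectralNorm ℚ_[p] (x + y), NormedAlgebra.norm_eq_spectralNorm ℚ_[p] x,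
    NormedAlgebra.norm_eq_spectralNorm ℚ_[p] y]
  exact isNonarchimedean_spectralNorm (K := ℚ_[p]) (L := K) x y

include p in
/-- **Rmk. 1.5.4 (i), abelian-variety clause, AT THE TATE CURVE**: for a finite extension `K` of `ℚ_p` (any
compatible norm) and `q ∈ K` with `0 < ‖q‖ < 1`, a point `P ∈ E_q(K)` lying in `n·E_q(K)` for every `n ≥ 1` is
`0` — "`⋂_{N ≥ 1} N · A(k) = {0}`" for `A = E_q`. [cite: MochizukiAbsTopIII2015, Rmk 1.5.4 (i) p.33] -/
theorem tateCurve_point_eq_zero_of_forall_exists_nsmul_eq {q : K} (hq0 : q ≠ 0) (hq : ‖q‖ < 1)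
    (P : (tateCurve q).toAffine.Point)
    (hP : ∀ n : ℕ, 0 < n → ∃ Q : (tateCurve q).toAffine.Point, n • Q = P) : P = 0 := by
  haveI : CharZero K := charZero_of_injective_algebraMap (algebraMap ℚ_[p] K).injective
  haveI : CompleteSpace K := FiniteDimensional.complete ℚ_[p] K
  haveI : IsUltrametricDist K := isUltrametricDist_of_finite_padic p
  exact point_eq_zero_of_divisible hq0 hq
    (fun x hx => (divisibleElementsTrivial_units_of_finite_padic p K).eq_one_of_forall_exists_pow x hx)
    (exists_norm_pow_eq_norm_zpow p hq0 hq) P hP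

include p in
/-- **Def. 1.5 (a) for the Mordell–Weil group of the Tate curve over a `p`-adic field** (the group `E_q(K)` written
multiplicatively): `⋂_N N·E_q(K) = {0}`. An INSTANCE of the abelian-variety clause of "sub-`p`-adic ⟹
Kummer-faithful" (the clause itself, for all abelian varieties, stays the named fact `Rmk_1_5_4_i`).
[cite: MochizukiAbsTopIII2015, Def 1.5 (a) p.32] -/
theorem divisibleElementsTrivial_tateCurve_points {q : K} (hq0 : q ≠ 0) (hq : ‖q‖ < 1) :
    DivisibleElementsTrivial (Multiplicative (tateCurve q).toAffine.Point) := by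
  refine ⟨fun x hx => ?_⟩
  have h := tateCurve_point_eq_zero_of_forall_exists_nsmul_eq p hq0 hq x.toAdd fun n hn => by
    obtain ⟨y, hy⟩ := hx n hn
    exact ⟨y.toAdd, by rw [← toAdd_pow, hy]⟩
  exact Multiplicative.toAdd.injective h

include p in
/-- **The same for every curve `K`-isomorphic to a Tate curve** — i.e., by the tree's PROVED Silverman ATAEC V.5.3
(`exists_tateParameter_of_hasSplitMultiplicativeReduction'`), for every elliptic curve over `K` with split
multiplicative reduction: if a change of variables `C` over `K` carries `E` to `E_q` (`C • E = tateCurve q`,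
`0 < ‖q‖ < 1`), then a point `P ∈ E(K)` lying in `n·E(K)` for every `n ≥ 1` is `0` (transport along the group
isomorphism `VariableChange.pointEquiv`). [cite: MochizukiAbsTopIII2015, Rmk 1.5.4 (i) p.33] -/
theorem point_eq_zero_of_forall_exists_nsmul_eq_of_variableChange {q : K} (hq0 : q ≠ 0) (hq : ‖q‖ < 1)
    {E : WeierstrassCurve K} (C : VariableChange K) (hC : C • E = tateCurve q) (P : E.toAffine.Point)
    (hP : ∀ n : ℕ, 0 < n → ∃ Q : E.toAffine.Point, n • Q = P) : P = 0 := by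
  -- transport of points along the EQUALITY `C • E = tateCurve q`
  have congr : ∀ {W₁ W₂ : WeierstrassCurve K}, W₁ = W₂ → Nonempty (W₁.toAffine.Point ≃+ W₂.toAffine.Point) :=
    fun h => by subst h; exact ⟨AddEquiv.refl _⟩
  obtain ⟨c⟩ := congr hC
  set e := (VariableChange.pointEquiv E C).trans c with he
  have h : e P = 0 :=
    tateCurve_point_eq_zero_of_forall_exists_nsmul_eq p hq0 hq (e P) fun n hn => by
      obtain ⟨Q, hQ⟩ := hP n hn
      exact ⟨e Q, by rw [← map_nsmul, hQ]⟩
  rw [← map_zero e] at h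
  exact e.injective h

/-! ### Over `ℚ_p` itself: every elliptic curve with split multiplicative reduction (unconditional) -/

section OverPadic

variable (p : ℕ) [Fact p.Prime]

/-- `‖x‖ ≤ 1 ↔ x ∈ ℤ_p` in `ℚ_p` (the valuation ring of `ℚ_p` is `ℤ_p`). [folklore] -/
private theorem padic_norm_le_one_iff_mem_range (x : ℚ_[p]) :
    ‖x‖ ≤ 1 ↔ x ∈ Set.range (algebraMap ℤ_[p] ℚ_[p]) := by
  constructor
  · intro h
    exact ⟨⟨x, h⟩, rfl⟩
  · rintro ⟨y, rfl⟩
    exact y.2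

/-- **An elliptic curve over `ℚ_p` with split multiplicative reduction has no non-zero infinitely divisible
`ℚ_p`-point** (Rmk. 1.5.4 (i), abelian-variety clause, for these curves — UNCONDITIONAL): some `ℚ_p`-model has split
multiplicative reduction over `ℤ_p`, hence (the tree's PROVED Silverman ATAEC V.5.3,
`exists_tateParameter_of_hasSplitMultiplicativeReduction'`) `E ≅ E_q` over `ℚ_p`, and `E_q(ℚ_p)` has no such point.
[cite: MochizukiAbsTopIII2015, Rmk 1.5.4 (i) p.33] -/
theorem padic_point_eq_zero_of_forall_exists_nsmul_eq (E : WeierstrassCurve ℚ_[p]) [E.IsElliptic]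
    (hsplit : ∃ C : VariableChange ℚ_[p], (C • E).HasSplitMultiplicativeReduction ℤ_[p]) (P : E.toAffine.Point)
    (hP : ∀ n : ℕ, 0 < n → ∃ Q : E.toAffine.Point, n • Q = P) : P = 0 := by
  obtain ⟨q, hq0, hq, -, -, C, hC⟩ :=
    exists_tateParameter_of_hasSplitMultiplicativeReduction' ℤ_[p] (padic_norm_le_one_iff_mem_range p) E hsplit
  exact point_eq_zero_of_forall_exists_nsmul_eq_of_variableChange p hq0 hq C hC P hP

/-- **An elliptic curve over `ℚ` with split multiplicative reduction at `p` has no non-zero infinitely divisible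
`ℚ_p`-point** (`E(ℚ_p) = (W ⊗ ℚ_p)(ℚ_p)`; the cell's `HasSplitMultiplicativeReductionAtPrime`).
[cite: MochizukiAbsTopIII2015, Rmk 1.5.4 (i) p.33] -/
theorem rat_point_eq_zero_of_forall_exists_nsmul_eq (W : WeierstrassCurve ℚ) [W.IsElliptic]
    (h : W.HasSplitMultiplicativeReductionAtPrime p) (P : (W.baseChange ℚ_[p]).toAffine.Point)
    (hP : ∀ n : ℕ, 0 < n → ∃ Q : (W.baseChange ℚ_[p]).toAffine.Point, n • Q = P) : P = 0 :=
  padic_point_eq_zero_of_forall_exists_nsmul_eq p (W.baseChange ℚ_[p]) ⟨_, h⟩ P hP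

end OverPadic

end Literature.AnabelianGeometry.AbsoluteAnabelian.AbsTopIII

end
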